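import Summits.Ventures.HodgeRepro2.T5AntidiagonalForm
import Summits.Ventures.HodgeRepro2.T5SplitPlaceHyperspecial

/-!
# T5UnitaryGroupOneEquiv — `U(1)` as a subgroup of `GL` is Mathlib's `unitaryGroup`; the split model

Blind cell pub-hodge-repro2, seat p8, Tier-5 kernel support (coherence file).

* `formUnitaryGroupOneEquiv : formUnitaryGroup (1 : Matrix ι ι E) ≃* Matrix.unitaryGroup ι E` — the
  inert-place carrier of T5UnitaryGroupForm for `J = 1` and Mathlib's unitary group of the matrix ring are
  the same group (T5AntidiagonalForm's `mem_formUnitaryGroup_one_iff` made into an isomorphism;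
  `Unitary.toUnits` for the inverse).
* `splitFormEquivGL : formUnitaryGroup (1 : Matrix ι ι (SplitAlg F)) ≃* GL ι F` — over the split algebra
  `F × F` (swap involution, p3's T5SplitUnitary) the inert-place carrier IS `GL_n(F)`.
* `mem_hyperspecialSplit_iff_formUnitaryGroup` — under `formUnitaryGroupOneEquiv`, p8's split hyperspecial
  subgroup `hyperspecialSplit R` (T5SplitPlaceHyperspecial) is the set of elements of
  `formUnitaryGroup 1` whose two coordinate matrices are entrywise `R`-integral: the ONE definition
  `formUnitaryGroup J` with `K = U ∩ GL_n(𝒪)` covers the inert places (`E_v` a field, T5UnitaryHeckeAdjoint)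
  and the split places (`E_v = F_v × F_v`, T5SplitPlaceHyperspecial) of the record.

Nothing new is assumed; the readings (which places are split / inert, the bases) stay prose.
-/

namespace Summit.Ventures.HodgeRepro2.T5UnitaryGroupOneEquiv

open Summit.Ventures.HodgeRepro2 Matrix

section Generic

variable {E : Type*} [CommRing E] [StarRing E] {ι : Type*} [Fintype ι] [DecidableEq ι]

/-- `U(1) ≤ GL ι E` is Mathlib's `Matrix.unitaryGroup ι E` (the unitary elements of the matrix ring):
`g ↦ ↑g`, inverse `Unitary.toUnits`. -/
def formUnitaryGroupOneEquiv :
    T5UnitaryGroupForm.formUnitaryGroup (1 : Matrix ι ι E) ≃* Matrix.unitaryGroup ι E where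
  toFun g := ⟨(g : GL ι E), (T5AntidiagonalForm.mem_formUnitaryGroup_one_iff (g : GL ι E)).1 g.2⟩
  invFun u := ⟨Unitary.toUnits u, (T5AntidiagonalForm.mem_formUnitaryGroup_one_iff _).2 u.2⟩
  left_inv _ := Subtype.ext (Units.ext rfl)
  right_inv _ := Subtype.ext rfl
  map_mul' _ _ := Subtype.ext rfl

/-- `formUnitaryGroupOneEquiv` on the underlying matrices. -/
theorem coe_formUnitaryGroupOneEquiv_apply (g : T5UnitaryGroupForm.formUnitaryGroup (1 : Matrix ι ι E)) :
    ((formUnitaryGroupOneEquiv g : Matrix.unitaryGroup ι E) : Matrix ι ι E) = ((g : GL ι E) : Matrix ι ι E) :=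
  rfl

/-- The inverse on the underlying matrices. -/
theorem coe_formUnitaryGroupOneEquiv_symm_apply (u : Matrix.unitaryGroup ι E) :
    (((formUnitaryGroupOneEquiv.symm u : T5UnitaryGroupForm.formUnitaryGroup (1 : Matrix ι ι E)) : GL ι E) :
      Matrix ι ι E) = (u : Matrix ι ι E) :=
  rfl

end Generic

section Split

variable {F : Type*} [Field F] {ι : Type*} [Fintype ι] [DecidableEq ι]

/-- Over the split algebra `F × F` the inert-place carrier `formUnitaryGroup 1` IS `GL ι F`
(p3's `unitaryGroupEquivGL` composed with `formUnitaryGroupOneEquiv`). -/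
def splitFormEquivGL :
    T5UnitaryGroupForm.formUnitaryGroup (1 : Matrix ι ι (T5SplitUnitary.SplitAlg F)) ≃* GL ι F :=
  formUnitaryGroupOneEquiv.trans T5SplitUnitary.unitaryGroupEquivGL

/-- `splitFormEquivGL` is the first coordinate. -/
theorem coe_splitFormEquivGL_apply
    (g : T5UnitaryGroupForm.formUnitaryGroup (1 : Matrix ι ι (T5SplitUnitary.SplitAlg F))) :
    ((splitFormEquivGL g : GL ι F) : Matrix ι ι F) =
      T5SplitUnitary.fst ((g : GL ι (T5SplitUnitary.SplitAlg F)) : Matrix ι ι (T5SplitUnitary.SplitAlg F)) :=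
  T5SplitUnitary.coe_unitaryGroupEquivGL_apply _

variable {R : Type*} [CommRing R] [IsDomain R] [Algebra R F] [IsFractionRing R F]

/-- THE TWO MODELS AGREE: `g ∈ formUnitaryGroup 1` (over `F × F`) corresponds to an element of p8's split
hyperspecial subgroup iff both coordinate matrices of `g` are entrywise `R`-integral — the lattice-stabiliser
description `K = U ∩ GL_n(𝒪 × 𝒪)`, the same shape as `hyperspecialSubgroup` at an inert place. -/
theorem mem_hyperspecialSplit_iff_formUnitaryGroup
    (g : T5UnitaryGroupForm.formUnitaryGroup (1 : Matrix ι ι (T5SplitUnitary.SplitAlg F))) :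
    formUnitaryGroupOneEquiv g ∈ T5SplitPlaceHyperspecial.hyperspecialSplit R ↔
      (∀ i j, IsLocalization.IsInteger R (T5SplitUnitary.fst
        ((g : GL ι (T5SplitUnitary.SplitAlg F)) : Matrix ι ι (T5SplitUnitary.SplitAlg F)) i j)) ∧
      (∀ i j, IsLocalization.IsInteger R (T5SplitUnitary.snd
        ((g : GL ι (T5SplitUnitary.SplitAlg F)) : Matrix ι ι (T5SplitUnitary.SplitAlg F)) i j)) :=
  T5SplitPlaceHyperspecial.mem_hyperspecialSplit_iff (formUnitaryGroupOneEquiv g)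

end Split

end Summit.Ventures.HodgeRepro2.T5UnitaryGroupOneEquiv
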